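import Literature.Analysis.Potential.RieszKernelGaussianSubordination
import Literature.MathematicalPhysics.QuantumLattice.GaussianFieldLaw
import Mathlib.Analysis.SpecialFunctions.Pow.Integral
import Mathlib.Analysis.SpecialFunctions.JapaneseBracket
import HarnessLib

/-!
# Subordination of the Riesz pairing `∬ u(x)|x−y|^{-α}w(y)` on `ℝ³` to the heat kernel (position space)

Analysis/Potential support file (everything proved; no definitions, no named facts), second of
three files proving the Fourier representation of the Riesz pairing (Stein, *Singular Integrals*,
Ch. V §1.1 Lemma 1(b)) by Gaussian subordination; see `RieszKernelFourierPairingProofs.lean`.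

* `integrable_one_add_norm_rpow_neg_mul_rieszKernel` — `|x|^{-α}` (`0 ≤ α < 3`) is a temperate
  kernel on `ℝ³`; `integrable_prod_rieszKernel` — `u(x)w(y)|x−y|^{-α}` is integrable on `ℝ³ × ℝ³`
  for real Schwartz `u, w` (`Literature.MathematicalPhysics.QuantumLattice.integrable_kernel_prod`);
* `integrable_prod_heatKernel` — so is `u(x)w(y)G_s(x−y)`, `s > 0`;
* `integral_prod_rieszKernel_eq_integral_Ioi` — for `0 < α < 3`,
  `∬ u(x)w(y)|x−y|^{-α} = C₁⁻¹ ∫₀^∞ s^{(1−α)/2} (∬ u(x)w(y)G_s(x−y)) ds`,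
  `C₁ = (4π)^{-3/2}4^{α/2}Γ(α/2)` (Fubini in `((x,y),s)`, template: the tree's
  `Literature.MathematicalPhysics.QuantumManyBody.Coulomb.coulombEnergy_eq_integral_Ioi`, `α = 1`).

References: E. M. Stein, *Singular Integrals and Differentiability Properties of Functions*
(1970), Ch. III §2.1, Ch. V §1.1; E. H. Lieb, M. Loss, *Analysis* (2001), Thm. 5.9, Thm. 9.8.
-/

noncomputable section

open MeasureTheory Set Filter
open scoped FourierTransform ComplexConjugate RealInnerProductSpace Real Topology SchwartzMap
open Literature.Analysis.UnboundedOperators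
open Literature.MathematicalPhysics.QuantumManyBody.BoseGas

namespace Literature.Analysis.Potential

/-- Shorthand for `ℝ³`. -/
local notation "E3" => EuclideanSpace ℝ (Fin 3)

/-- Real part of a Bochner integral of an integrable complex function. [folklore] -/
theorem integral_complex_re {X : Type*} [MeasurableSpace X] {μ : Measure X} {f : X → ℂ}
    (hf : Integrable f μ) : ∫ x, (f x).re ∂μ = (∫ x, f x ∂μ).re := by
  simpa only [RCLike.re_to_complex] using integral_re hf

/-! ### Absolute convergence in position space -/

/-- The Riesz kernel `|x|^{-α}`, `0 ≤ α < 3`, is temperate on `ℝ³`: `(1 + |x|)^{-4}|x|^{-α}` is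
integrable (local integrability near `0`, Mathlib's `integrableOn_ball_of_norm_le_rpow`, and the
integrable tail `(1 + |x|)^{-4}`). [folklore] -/
theorem integrable_one_add_norm_rpow_neg_mul_rieszKernel {α : ℝ} (h0 : 0 ≤ α) (h3 : α < 3) :
    Integrable fun x : E3 => (1 + ‖x‖) ^ (-((4 : ℕ) : ℝ)) * ‖x‖ ^ (-α) := by
  have hd : Module.finrank ℝ E3 = 3 := finrank_euclideanSpace_fin
  have hj : Integrable ((Metric.ball (0 : E3) 1).indicator fun x : E3 => ‖x‖ ^ (-α)) := by
    rw [integrable_indicator_iff Metric.isOpen_ball.measurableSet]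
    refine integrableOn_ball_of_norm_le_rpow (by rw [hd]; norm_num) (C := 1) (α := α) (r := 1)
      (by rw [hd]; exact_mod_cast h3) (Eventually.of_forall fun x => ?_)
      ((measurable_norm.pow_const _).aestronglyMeasurable)
    rw [one_mul, Real.norm_eq_abs, abs_of_nonneg (Real.rpow_nonneg (norm_nonneg _) _)]
  have hw : Integrable fun x : E3 => (1 + ‖x‖) ^ (-((4 : ℕ) : ℝ)) :=
    integrable_one_add_norm (by rw [hd]; norm_num)
  refine (hj.add hw).mono' (((measurable_norm.const_add 1).pow_const _).mul
    (measurable_norm.pow_const _)).aestronglyMeasurable (Eventually.of_forall fun x => ?_)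
  have hk : 0 ≤ ‖x‖ ^ (-α) := Real.rpow_nonneg (norm_nonneg _) _
  have hwx : 0 ≤ (1 + ‖x‖) ^ (-((4 : ℕ) : ℝ)) := Real.rpow_nonneg (by positivity) _
  have hw1 : (1 + ‖x‖) ^ (-((4 : ℕ) : ℝ)) ≤ 1 :=
    Real.rpow_le_one_of_one_le_of_nonpos (by linarith [norm_nonneg x]) (by norm_num)
  rw [Real.norm_eq_abs, abs_of_nonneg (mul_nonneg hwx hk), Pi.add_apply]
  by_cases hx : x ∈ Metric.ball (0 : E3) 1
  · rw [Set.indicator_of_mem hx]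
    calc (1 + ‖x‖) ^ (-((4 : ℕ) : ℝ)) * ‖x‖ ^ (-α) ≤ 1 * ‖x‖ ^ (-α) :=
          mul_le_mul_of_nonneg_right hw1 hk
      _ ≤ ‖x‖ ^ (-α) + (1 + ‖x‖) ^ (-((4 : ℕ) : ℝ)) := by linarith
  · rw [Set.indicator_of_notMem hx, zero_add]
    rw [Metric.mem_ball, dist_zero_right, not_lt] at hx
    have hk1 : ‖x‖ ^ (-α) ≤ 1 := Real.rpow_le_one_of_one_le_of_nonpos hx (by linarith)
    exact (mul_le_mul_of_nonneg_left hk1 hwx).trans (by rw [mul_one])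

/-- For real Schwartz `u, w` on `ℝ³` and `0 ≤ α < 3`, `(x, y) ↦ u(x) w(y) |x − y|^{-α}` is
integrable on `ℝ³ × ℝ³` (`integrable_kernel_prod` for the temperate kernel `|·|^{-α}`). [folklore] -/
theorem integrable_prod_rieszKernel (u w : 𝓢(E3, ℝ)) {α : ℝ} (h0 : 0 ≤ α) (h3 : α < 3) :
    Integrable (fun z : E3 × E3 => u z.1 * w z.2 * ‖z.1 - z.2‖ ^ (-α)) (volume.prod volume) := by
  have h := Literature.MathematicalPhysics.QuantumLattice.integrable_kernel_prod
    (K := fun x : E3 => ‖x‖ ^ (-α)) (integrable_one_add_norm_rpow_neg_mul_rieszKernel h0 h3) u w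
  refine h.congr (Eventually.of_forall fun z => ?_)
  simp only
  ring

/-- The diagonal of `ℝ³ × ℝ³` is Lebesgue-null. [folklore] -/
theorem ae_fst_ne_snd_E3 : ∀ᵐ z : E3 × E3 ∂(volume.prod volume), z.1 ≠ z.2 := by
  have hmeas : MeasurableSet {z : E3 × E3 | z.1 = z.2} :=
    (isClosed_eq continuous_fst continuous_snd).measurableSet
  have h0 : (volume.prod volume) {z : E3 × E3 | z.1 = z.2} = 0 := by
    rw [Measure.measure_prod_null hmeas]
    refine Eventually.of_forall fun x => ?_
    have : Prod.mk x ⁻¹' {z : E3 × E3 | z.1 = z.2} = {x} := by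
      ext y
      simp [eq_comm]
    simp only [this, measure_singleton, Pi.zero_apply]
  rw [ae_iff]
  simpa only [ne_eq, not_not] using h0

/-- For `s > 0` and real Schwartz `u, w`, `(x, y) ↦ u(x) w(y) G_s(x − y)` is integrable on
`ℝ³ × ℝ³` (the heat kernel is bounded). [folklore] -/
theorem integrable_prod_heatKernel (u w : 𝓢(E3, ℝ)) {s : ℝ} (hs : 0 < s) :
    Integrable (fun z : E3 × E3 => u z.1 * w z.2 * heatKernel s (z.1 - z.2)) (volume.prod volume) := by
  have hGb : ∀ v : E3, |heatKernel s v| ≤ (4 * π * s) ^ (-(3 : ℝ) / 2) := fun v => by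
    rw [abs_of_pos (heatKernel_pos hs v)]
    have h := heatKernel_le hs v
    rw [finrank_euclideanSpace_fin] at h
    exact_mod_cast h
  have hb : Integrable (fun z : E3 × E3 => ‖u z.1‖ * (‖w z.2‖ * (4 * π * s) ^ (-(3 : ℝ) / 2)))
      (volume.prod volume) := u.integrable.norm.mul_prod (w.integrable.norm.mul_const _)
  refine hb.mono' ?_ (Eventually.of_forall fun z => ?_)
  · exact (((u.continuous.measurable.comp measurable_fst).mul
      (w.continuous.measurable.comp measurable_snd)).mul
      ((continuous_heatKernel s).measurable.comp (measurable_fst.sub measurable_snd))).aestronglyMeasurable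
  · rw [Real.norm_eq_abs, abs_mul, abs_mul, mul_assoc, ← Real.norm_eq_abs, ← Real.norm_eq_abs]
    gcongr
    exact hGb _

/-! ### Step 1: subordination in position space, Fubini in `((x, y), s)` -/

/-- **Subordination of the Riesz pairing** (position space): for `0 < α < 3` and real Schwartz
`u, w`, `∬ u(x) w(y) |x − y|^{-α} d(x,y) = C₁⁻¹ ∫₀^∞ s^{(1−α)/2} (∬ u(x) w(y) G_s(x − y)) ds`
with `C₁ = (4π)^{-3/2} 4^{α/2} Γ(α/2)`; Fubini in `((x, y), s)` is justified by the absolute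
convergence of the Riesz pairing. [folklore] -/
theorem integral_prod_rieszKernel_eq_integral_Ioi (u w : 𝓢(E3, ℝ)) {α : ℝ} (h0 : 0 < α)
    (h3 : α < 3) :
    ∫ z : E3 × E3, u z.1 * w z.2 * ‖z.1 - z.2‖ ^ (-α) ∂(volume.prod volume) =
      ((4 * π) ^ (-(3 / 2 : ℝ)) * (4 : ℝ) ^ (α / 2) * Real.Gamma (α / 2))⁻¹ *
        ∫ s in Ioi (0 : ℝ), s ^ ((1 - α) / 2) *
          ∫ z : E3 × E3, u z.1 * w z.2 * heatKernel s (z.1 - z.2) ∂(volume.prod volume) := by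
  set C : ℝ := (4 * π) ^ (-(3 / 2 : ℝ)) * (4 : ℝ) ^ (α / 2) * Real.Gamma (α / 2) with hC
  have hCpos : 0 < C := by
    have := Real.Gamma_pos_of_pos (by linarith : 0 < α / 2)
    positivity
  set μ : Measure (E3 × E3) := volume.prod volume with hμ
  set ν : Measure ℝ := volume.restrict (Ioi 0) with hν
  set K : (E3 × E3) × ℝ → ℝ := fun q =>
    u q.1.1 * w q.1.2 * (q.2 ^ ((1 - α) / 2) * heatKernel q.2 (q.1.1 - q.1.2)) with hK
  have hker_m : Measurable fun q : ℝ × E3 => heatKernel q.1 q.2 := by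
    have : (fun q : ℝ × E3 => heatKernel q.1 q.2) =
        fun q => (4 * π * q.1) ^ (-(3 / 2 : ℝ)) * Real.exp (-‖q.2‖ ^ 2 / (4 * q.1)) :=
      funext fun q => heatKernel_three q.1 q.2
    rw [this]
    exact ((measurable_const.mul measurable_fst).pow_const _).mul (by fun_prop)
  have hKm : Measurable K := by
    refine ((u.continuous.measurable.comp (measurable_fst.comp measurable_fst)).mul
      (w.continuous.measurable.comp (measurable_snd.comp measurable_fst))).mul
      ((measurable_snd.pow_const _).mul (hker_m.comp (measurable_snd.prodMk
        ((measurable_fst.comp measurable_fst).sub (measurable_snd.comp measurable_fst)))))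
  -- the `s`-integrals off the diagonal
  have hsec : ∀ z : E3 × E3, z.1 ≠ z.2 →
      ∫ s in Ioi (0 : ℝ), K (z, s) = u z.1 * w z.2 * (C * ‖z.1 - z.2‖ ^ (-α)) := by
    intro z hz
    simp only [hK]
    rw [integral_const_mul, (integral_Ioi_rpow_mul_heatKernel h0 (sub_ne_zero.2 hz)).2]
  have hsec_norm : ∀ z : E3 × E3, z.1 ≠ z.2 →
      ∫ s in Ioi (0 : ℝ), ‖K (z, s)‖ = ‖u z.1 * w z.2 * ‖z.1 - z.2‖ ^ (-α)‖ * C := by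
    intro z hz
    have hw : z.1 - z.2 ≠ 0 := sub_ne_zero.2 hz
    have h1 : ∀ s ∈ Ioi (0 : ℝ), ‖K (z, s)‖ =
        |u z.1 * w z.2| * (s ^ ((1 - α) / 2) * heatKernel s (z.1 - z.2)) := by
      intro s hs
      have hs0 : 0 < s := hs
      simp only [hK, Real.norm_eq_abs, abs_mul, abs_of_pos (heatKernel_pos hs0 _),
        abs_of_pos (Real.rpow_pos_of_pos hs0 _)]
    rw [setIntegral_congr_fun measurableSet_Ioi h1, integral_const_mul,
      (integral_Ioi_rpow_mul_heatKernel h0 hw).2, Real.norm_eq_abs,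
      abs_mul (u z.1 * w z.2) (‖z.1 - z.2‖ ^ (-α)), abs_of_nonneg (Real.rpow_nonneg (norm_nonneg _) _)]
    rw [hC]
    ring
  -- integrability of `K` on the product
  have hfin := integrable_prod_rieszKernel u w h0.le h3
  have hKi : Integrable K (μ.prod ν) := by
    rw [integrable_prod_iff hKm.aestronglyMeasurable]
    constructor
    · filter_upwards [ae_fst_ne_snd_E3] with z hz
      simp only [hK]
      exact ((integral_Ioi_rpow_mul_heatKernel h0 (sub_ne_zero.2 hz)).1).const_mul _
    · refine (hfin.norm.mul_const C).congr ?_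
      filter_upwards [ae_fst_ne_snd_E3] with z hz
      exact (hsec_norm z hz).symm
  -- the `z`-integral at fixed `s > 0`
  have hslice : ∀ s ∈ Ioi (0 : ℝ), ∫ z, K (z, s) ∂μ =
      s ^ ((1 - α) / 2) * ∫ z : E3 × E3, u z.1 * w z.2 * heatKernel s (z.1 - z.2) ∂μ := by
    intro s _
    simp only [hK]
    rw [← integral_const_mul]
    refine integral_congr_ae (Eventually.of_forall fun z => ?_)
    ring
  -- Fubini both ways
  have h1 : ∫ q, K q ∂(μ.prod ν) = C * ∫ z, u z.1 * w z.2 * ‖z.1 - z.2‖ ^ (-α) ∂μ := by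
    rw [integral_prod _ hKi, ← integral_const_mul]
    refine integral_congr_ae ?_
    filter_upwards [ae_fst_ne_snd_E3] with z hz
    rw [hsec z hz]
    ring
  have h2 : ∫ q, K q ∂(μ.prod ν) = ∫ s in Ioi (0 : ℝ), ∫ z, K (z, s) ∂μ := by
    rw [integral_prod_symm _ hKi]
  rw [setIntegral_congr_fun measurableSet_Ioi hslice] at h2
  rw [← h2, h1, ← mul_assoc, inv_mul_cancel₀ hCpos.ne', one_mul]

end Literature.Analysis.Potential

end
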